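import Summits.BirchSwinnertonDyer.Rank1Residual.X11b.Three.ValueReciprocityDictionary
import Literature.NumberTheory.EllipticCurves.NewformPeterssonSizeSymmSquareProofs
import Literature.NumberTheory.EllipticCurves.LFunctionCoefficientBound
import HarnessLib

/-!
# X11b @ `p = 3`, S30: (VR) ⟺ (VR_norm) — the value-reciprocity dictionary is an EQUIVALENCE

HONEST FRAMING (cell `b2b-bsdres`, run/shared/lean/b2b/bsd-rank1-residual/, verbatim in every
file): the goal of the cell is to DELETE the COMBINATION-SHAPED residual classes of the
Birch–Swinnerton-Dyer formula for ALL analytic-rank `≤ 1` elliptic curves over `ℚ` — assembled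
STRICTLY from published theorems — so that the rank-`≤ 1` remainder becomes exactly the
CONSTRUCTION-SHAPED classes, which are TYPED, NOT attempted. This is not "finishing BSD". Team N8/O2
(X11b at `3`); deal S30 (x11b3-lead GEN 9, OWNERS R10-18 (B)), seat `b2b-bsdres-x11b3-p1` (gen. 4),
second file of the dictionary `ValueReciprocityDictionary` (p289586; lead R10-30 GO). **WORDING OF
RECORD (R10-30, binding): (VR) ⟺ (VR_norm) in the kernel — a REFORMULATION that loses nothing; both
OPEN labelled hypotheses; nothing discharged; nothing booked** (R10-18: 'RE-EXPRESSES (t) ⟸ (VR_norm) =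
(VR) on the bare normalized Rankin–Selberg central values; (VR_norm) ⟹ (VR) kernel'). This file adds
the CONVERSE (VR) ⟹ (VR_norm) — claimed and kernel-checked here; the other converse (VR_loc) ⟹ (VR) of
K4′ is NOT claimed anywhere. EVIDENCE on hypothesis strength, exactly as S30-e calibrates the node
against (VR_loc). (VR) and (VR_norm) are LABELLED HYPOTHESES (the planner's binder v3 / its normalized
form), NOT published numbered statements and NOT Literature facts. The node `Three.HsiehDescentAt₃` is UNCHANGED (no
`_holds`, nothing appended); O2 OPEN / N8 CONSTRUCTION; nothing booked; no mark / label / count /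
tier moved. THEOREMS ONLY (no definition, no named fact, no `sorry`).

## What this file proves

With `M(χ, n; Ω) = bdpInterpolationValue p f 𝔭 χ n Ω = κ_𝔭(χ, n)·A(χ, n; Ω)`,
`κ_𝔭(χ, n) = Γ(n)Γ(n+1)·(1 − a_p p⁻¹ χ(𝔭) + ε_p χ(𝔭)²)²`, `A(χ, n; Ω) = L(f/K, χ, 1)/(π^{2n+1}·Ω^{4n})`:

* `norm_valueAtUniformizer_eq_one_of_weight_zero` — **`|χ(ϖ_v)| = 1`** for `χ` unramified
  everywhere of weight-`0` infinity type (`p_w + q_w = 0`; the RANGE type `(n, −n)`): Weil purity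
  (tree `HasInfinityType.norm_valueAtUniformizer_sq`) at weight `0` on the EMPTY module of definition.
* `eulerFactor_ne_zero_of_norm_eq_one` — **`E_𝔭 ≠ 0` on the unit circle** for the newform of a
  Weierstrass curve over `ℚ` and every prime `p`: `p² ∣ N` ⇒ `a_p = 0`; `p ‖ N` ⇒ `a_p² = 1`
  (Atkin–Lehner, tree `IsNewform0.cuspCoeff_sq_eq_one_of_dvd_of_not_sq_dvd`); `p ∤ N` ⇒ a unit-circle
  root of `x² − a_p x + p` is `±1`, forcing `|a_p| = p + 1 > 2√p` (Hasse, tree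
  `abs_LFunction_prime_pow_le`).
* `elementaryFactor_autConj_ne_zero` — `κ_𝔭(^σχ, n) ≠ 0` for `n ≥ 1` and EVERY `σ ∈ Aut(ℂ)`:
  `E_𝔭(^σχ)² = σ(E_𝔭(χ)²)` by the dictionary (no bound on `|σ z|` is needed).
* `normalizedValue_exact_of_bdpInterpolationValue_exact`,
  `normalizedValue_cocycle_of_bdpInterpolationValue_cocycle` — pointwise converse transfers (cancel
  `κ_𝔭(^σχ, n)`).
* `normalizedValueReciprocity_of_valueReciprocity : (VR) → (VR_norm)` and
  **`valueReciprocity_iff_normalizedValueReciprocity : (VR) ↔ (VR_norm)`** (texts: `hVR` of p287576 /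
  the (VR_norm) of `ValueReciprocityDictionary`, both VERBATIM; needs `[W.IsElliptic]` for Hasse).

References: [Castella2018] Thm. 3.1 (the value); [Weil1956] §1; [AtkinLehner1970] Thm. 3; Hasse;
cell files OWNERS R10-18, `ValueReciprocityDictionary` (p289586).
-/

noncomputable section

open scoped NumberField ComplexConjugate
open NumberField IsDedekindDomain Field WeierstrassCurve
open Literature.NumberTheory.GaloisRepresentations Literature.NumberTheory.EllipticCurves
open Literature.NumberTheory.EllipticCurves.ModularForms

namespace Summit.BirchSwinnertonDyer.Rank1Residual.X11b.Three

/-! ### §1. Unit-circle values of weight-zero unramified characters -/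

section UnitValues

variable {K : Type} [Field K] [NumberField K]

/-- **`|χ(ϖ_v)| = 1`** at every finite place for a Hecke character that is unramified everywhere and
has infinity type `(p, q)` of weight `0` (`p_w + q_w = 0` at every infinite place — e.g. the
anticyclotomic RANGE type `(n, −n)`): Weil's purity `|χ(ϖ_v)|² = Nv^w` off the module of definition
(tree `HasInfinityType.norm_valueAtUniformizer_sq`), with `w = 0` and the EMPTY module
(`exists_isModulus` + `IsModulus.of_isUnramifiedAt`). [cite: Weil1956, §1] -/
theorem norm_valueAtUniformizer_eq_one_of_weight_zero {χ : HeckeCharacter K}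
    {p q : InfinitePlace K → ℤ} (hχ : χ.HasInfinityType p q) (hpq : ∀ w, p w + q w = 0)
    (hunr : ∀ v : HeightOneSpectrum (𝓞 K), χ.IsUnramifiedAt v) (v : HeightOneSpectrum (𝓞 K)) :
    ‖χ.valueAtUniformizer v‖ = 1 := by
  obtain ⟨T, e, hmod⟩ := χ.exists_isModulus
  have hmod' : χ.IsModulus ∅ e := hmod.of_isUnramifiedAt fun w _ _ ↦ hunr w
  have h := hχ.norm_valueAtUniformizer_sq hmod' (wt := 0)
    (fun w ↦ by rw [hpq w]; ring) (v := v) (Finset.notMem_empty v)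
  rw [zpow_zero] at h
  exact (pow_eq_one_iff_of_nonneg (norm_nonneg _) two_ne_zero).mp h

end UnitValues

/-! ### §2. The elementary factor does not vanish on the range -/

section EulerFactor

variable {K : Type} [Field K] [NumberField K] {N : ℕ} [NeZero N] {W : WeierstrassCurve ℚ}
  [W.IsElliptic] {f : CuspForm (CongruenceSubgroup.Gamma0 N) 2}

/-- **The Euler-type factor does not vanish on the unit circle**: for the newform `f ∈ S₂(Γ₀(N))`
of a Weierstrass curve `W/ℚ`, a prime `p` and `|x| = 1`,
`1 − a_p p⁻¹ x + ε_p x² ≠ 0` (`ε_p = 0` if `p ∣ N`, else `p⁻¹`). Cases: `p² ∣ N` ⇒ `a_p = 0`;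
`p ‖ N` ⇒ `a_p² = 1` (Atkin–Lehner 1970, Thm. 3: tree
`IsNewform0.cuspCoeff_sq_eq_one_of_dvd_of_not_sq_dvd`) and `|a_p x| = 1 < p`; `p ∤ N` ⇒ a root `x`
of `x² − a_p x + p` on the unit circle satisfies `x̄ = x⁻¹`, whence `(p − 1)(x² − 1) = 0`, `x = ±1`
and `|a_p| = p + 1`, against Hasse `|a_p| ≤ 2√p` (tree `abs_LFunction_prime_pow_le`).
[cite: AtkinLehner1970, Thm. 3] -/
theorem eulerFactor_ne_zero_of_norm_eq_one (hf : IsNewformOf W f) {p : ℕ} (hp : p.Prime) {x : ℂ}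
    (hx : ‖x‖ = 1) :
    1 - cuspCoeff f p * ((p : ℂ))⁻¹ * x + (if p ∣ N then (0 : ℂ) else ((p : ℂ))⁻¹) * x ^ 2 ≠ 0 := by
  have hp2 : (2 : ℝ) ≤ p := by exact_mod_cast hp.two_le
  have hp0 : (p : ℂ) ≠ 0 := by exact_mod_cast hp.ne_zero
  have ha : cuspCoeff f p = ((W.LFunction p : ℤ) : ℂ) := hf.2 p
  have hx0 : x ≠ 0 := by
    intro h; rw [h, norm_zero] at hx; exact zero_ne_one hx
  by_cases hpN : p ∣ N
  · rw [if_pos hpN, zero_mul, add_zero]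
    by_cases hp2N : p ^ 2 ∣ N
    · rw [hf.1.cuspCoeff_eq_zero_of_sq_dvd hp hp2N, zero_mul, zero_mul, sub_zero]
      exact one_ne_zero
    · have hsq : cuspCoeff f p ^ 2 = 1 := hf.1.cuspCoeff_sq_eq_one_of_dvd_of_not_sq_dvd hp hpN hp2N
      have hna : ‖cuspCoeff f p‖ = 1 := by
        have := congrArg (‖·‖) hsq
        simp only [norm_pow, norm_one] at this
        exact (pow_eq_one_iff_of_nonneg (norm_nonneg _) two_ne_zero).mp this
      intro h
      -- `a_p x = p`
      have h1 : cuspCoeff f p * x = p := by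
        field_simp at h
        linear_combination -h
      have h2 : ‖cuspCoeff f p * x‖ = p := by rw [h1, Complex.norm_natCast]
      rw [norm_mul, hna, hx, one_mul] at h2
      linarith
  · rw [if_neg hpN]
    intro h
    -- (I) `x² − a x + p = 0`
    have hI : x ^ 2 - cuspCoeff f p * x + p = 0 := by
      field_simp at h
      linear_combination h
    -- conjugate: `x̄ = x⁻¹`, `a`, `p` real ⇒ (II) `p x² − a x + 1 = 0`
    have hconj : conj x = x⁻¹ := (Complex.inv_eq_conj hx).symm
    have hII : (p : ℂ) * x ^ 2 - cuspCoeff f p * x + 1 = 0 := by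
      have := congrArg conj hI
      rw [map_add, map_sub, map_pow, map_mul, map_natCast, map_zero, ha, map_intCast, hconj] at this
      rw [ha]
      field_simp at this
      linear_combination this
    -- (II) − (I) ⇒ `(p − 1)(x² − 1) = 0` ⇒ `x² = 1`
    have hp1 : (p : ℂ) - 1 ≠ 0 := by
      have : (1 : ℂ) ≠ p := by exact_mod_cast hp.one_lt.ne
      exact sub_ne_zero.mpr this.symm
    have hx2 : x ^ 2 = 1 := by
      have h3 : ((p : ℂ) - 1) * (x ^ 2 - 1) = 0 := by linear_combination hII - hI
      rcases mul_eq_zero.mp h3 with h3 | h3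
      · exact absurd h3 hp1
      · exact sub_eq_zero.mp h3
    -- then `a x = p + 1`, `|a| = p + 1`, contradicting Hasse `|a| ≤ 2√p`
    have h4 : cuspCoeff f p * x = p + 1 := by linear_combination hx2 - hI
    have h5 : ‖cuspCoeff f p‖ = p + 1 := by
      have := congrArg (‖·‖) h4
      simp only [norm_mul, hx, mul_one] at this
      rw [this]
      exact_mod_cast Complex.norm_natCast (p + 1)
    have hH : |(W.LFunction p : ℝ)| ≤ 2 * Real.sqrt p := by
      have := W.abs_LFunction_prime_pow_le hp 1
      norm_num at this
      exact this
    have hnorm : ‖cuspCoeff f p‖ = |(W.LFunction p : ℝ)| := by rw [ha, Complex.norm_intCast]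
    rw [hnorm] at h5
    rw [h5] at hH
    have hs : Real.sqrt p ^ 2 = p := Real.sq_sqrt (by positivity)
    nlinarith [Real.sqrt_nonneg (p : ℝ)]

/-- **The elementary factor `κ_𝔭(^σχ, n) = Γ(n)Γ(n+1)·E_𝔭(^σχ)²` of the CONJUGATE character does not
vanish** for `n ≥ 1`, `χ` unramified everywhere of weight-`0` infinity type, `f` the newform of `W`,
`p` prime, ANY `σ ∈ Aut(ℂ)`: `E_𝔭(^σχ)² = σ(E_𝔭(χ)²)` (the dictionary's `algEquiv_apply_eulerFactorSq`
— no bound on `|σ z|` is ever needed) and `E_𝔭(χ) ≠ 0` on the unit circle. [cite: Weil1956, §1]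
[cite: AtkinLehner1970, Thm. 3] -/
theorem elementaryFactor_autConj_ne_zero (hf : IsNewformOf W f) {p : ℕ} (hp : p.Prime)
    (𝔭 : HeightOneSpectrum (𝓞 K)) {χ : HeckeCharacter K} {p' q' : InfinitePlace K → ℤ}
    (hχ : χ.HasInfinityType p' q') (hpq : ∀ w, p' w + q' w = 0)
    (hunr : ∀ v : HeightOneSpectrum (𝓞 K), χ.IsUnramifiedAt v) {n : ℕ} (hn : 0 < n)
    (σ : ℂ ≃ₐ[ℚ] ℂ) :
    Complex.Gamma n * Complex.Gamma (n + 1) *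
        (1 - cuspCoeff f p * ((p : ℂ))⁻¹ * heckeValueExtZero (hχ.autConj σ) 𝔭 +
            (if p ∣ N then (0 : ℂ) else ((p : ℂ))⁻¹) * heckeValueExtZero (hχ.autConj σ) 𝔭 ^ 2) ^ 2 ≠ 0 := by
  have ha : ∃ a : ℤ, cuspCoeff f p = a := exists_int_cuspCoeff_eq_of_isNewformOf hf p
  -- Γ(n)Γ(n+1) ≠ 0 for n ≥ 1
  have hΓ : Complex.Gamma n * Complex.Gamma (n + 1) ≠ 0 := by
    obtain ⟨m, rfl⟩ := Nat.exists_eq_succ_of_ne_zero hn.ne'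
    rw [Nat.cast_succ, Complex.Gamma_nat_eq_factorial,
      show (m : ℂ) + 1 + 1 = ((m + 1 : ℕ) : ℂ) + 1 by push_cast; ring, Complex.Gamma_nat_eq_factorial]
    exact mul_ne_zero (by exact_mod_cast (Nat.factorial_ne_zero m))
      (by exact_mod_cast (Nat.factorial_ne_zero (m + 1)))
  -- E_𝔭(χ) ≠ 0 on the unit circle, transported through σ
  have hE : 1 - cuspCoeff f p * ((p : ℂ))⁻¹ * heckeValueExtZero χ 𝔭 +
      (if p ∣ N then (0 : ℂ) else ((p : ℂ))⁻¹) * heckeValueExtZero χ 𝔭 ^ 2 ≠ 0 := by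
    rw [heckeValueExtZero_of_isUnramifiedAt (hunr 𝔭)]
    exact eulerFactor_ne_zero_of_norm_eq_one hf hp
      (norm_valueAtUniformizer_eq_one_of_weight_zero hχ hpq hunr 𝔭)
  have hEσ := (map_ne_zero σ).mpr (pow_ne_zero 2 hE)
  rw [epsilon_eq_ratCast, algEquiv_apply_eulerFactorSq p ha hχ σ 𝔭, ← epsilon_eq_ratCast] at hEσ
  exact mul_ne_zero hΓ hEσ

/-- **Pointwise EXACTNESS transfer, converse direction**: if `σ` is exact on the interpolation value,
`σ M(χ, n; Ω) = M(^σχ, n; Ω)`, then it is exact on the normalized central value,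
`σ A(χ, n; Ω) = A(^σχ, n; Ω)` — for `χ` unramified everywhere of weight-`0` type and `n ≥ 1` (so that
`κ_𝔭(^σχ, n) ≠ 0` can be cancelled). [cite: Castella2018, Thm. 3.1] [cite: Weil1956, §1] -/
theorem normalizedValue_exact_of_bdpInterpolationValue_exact (hf : IsNewformOf W f) {p : ℕ}
    (hp : p.Prime) (𝔭 : HeightOneSpectrum (𝓞 K)) {χ : HeckeCharacter K}
    {p' q' : InfinitePlace K → ℤ} (hχ : χ.HasInfinityType p' q') (hpq : ∀ w, p' w + q' w = 0)
    (hunr : ∀ v : HeightOneSpectrum (𝓞 K), χ.IsUnramifiedAt v) {n : ℕ} (hn : 0 < n) (Ω : ℂ)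
    (σ : ℂ ≃ₐ[ℚ] ℂ)
    (hM : σ (bdpInterpolationValue p f 𝔭 χ n Ω) = bdpInterpolationValue p f 𝔭 (hχ.autConj σ) n Ω) :
    σ (rankinSelbergValueHecke f χ 1 / ((Real.pi : ℂ) ^ (2 * n + 1) * Ω ^ (4 * n))) =
      rankinSelbergValueHecke f (hχ.autConj σ) 1 / ((Real.pi : ℂ) ^ (2 * n + 1) * Ω ^ (4 * n)) := by
  have ha : ∃ a : ℤ, cuspCoeff f p = a := exists_int_cuspCoeff_eq_of_isNewformOf hf p
  rw [algEquiv_apply_bdpInterpolationValue p ha 𝔭 hχ n Ω σ,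
    bdpInterpolationValue_eq_elementary_mul_normalizedValue p f 𝔭 (hχ.autConj σ) n Ω] at hM
  exact mul_left_cancel₀ (elementaryFactor_autConj_ne_zero hf hp 𝔭 hχ hpq hunr hn σ) hM

/-- **Pointwise COCYCLE transfer, converse direction**: `σ M(χ, n; Ω) = D · M(^σχ, n; Ω)` implies
`σ A(χ, n; Ω) = D · A(^σχ, n; Ω)` with the SAME `D`, under the same cancellation hypotheses.
[cite: Castella2018, Thm. 3.1] [cite: Weil1956, §1] -/
theorem normalizedValue_cocycle_of_bdpInterpolationValue_cocycle (hf : IsNewformOf W f) {p : ℕ}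
    (hp : p.Prime) (𝔭 : HeightOneSpectrum (𝓞 K)) {χ : HeckeCharacter K}
    {p' q' : InfinitePlace K → ℤ} (hχ : χ.HasInfinityType p' q') (hpq : ∀ w, p' w + q' w = 0)
    (hunr : ∀ v : HeightOneSpectrum (𝓞 K), χ.IsUnramifiedAt v) {n : ℕ} (hn : 0 < n) (Ω D : ℂ)
    (σ : ℂ ≃ₐ[ℚ] ℂ)
    (hM : σ (bdpInterpolationValue p f 𝔭 χ n Ω) = D * bdpInterpolationValue p f 𝔭 (hχ.autConj σ) n Ω) :
    σ (rankinSelbergValueHecke f χ 1 / ((Real.pi : ℂ) ^ (2 * n + 1) * Ω ^ (4 * n))) =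
      D * (rankinSelbergValueHecke f (hχ.autConj σ) 1 / ((Real.pi : ℂ) ^ (2 * n + 1) * Ω ^ (4 * n))) := by
  have ha : ∃ a : ℤ, cuspCoeff f p = a := exists_int_cuspCoeff_eq_of_isNewformOf hf p
  rw [algEquiv_apply_bdpInterpolationValue p ha 𝔭 hχ n Ω σ,
    bdpInterpolationValue_eq_elementary_mul_normalizedValue p f 𝔭 (hχ.autConj σ) n Ω] at hM
  refine mul_left_cancel₀ (elementaryFactor_autConj_ne_zero hf hp 𝔭 hχ hpq hunr hn σ) ?_
  rw [hM]
  ring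

end EulerFactor

/-! ### §3. (VR) ⟹ (VR_norm): the re-expression is an EQUIVALENCE -/

section Converse

variable (W : WeierstrassCurve ℚ) [W.IsElliptic]

/-- **(VR) ⟹ (VR_norm) — kernel (the converse of `valueReciprocity_of_normalizedValueReciprocity`).**
On the interpolation RANGE (`χ` unramified everywhere of type `(n, −n)`, `n ≥ 1`) the elementary
factor `κ_𝔭(^σχ, n) = Γ(n)Γ(n+1)·E_𝔭(^σχ)²` never vanishes (`|χ(𝔭)| = 1` by Weil purity at weight
`0`; `E_𝔭 ≠ 0` on the unit circle by Atkin–Lehner `a_p ∈ {0, ±1}` at `p ∣ N` and Hasse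
`|a_p| ≤ 2√p` at `p ∤ N`; transported through `σ` by the dictionary), so it cancels: the cocycle /
exactness identities for `M = κ·A` give those for `A` with the same `Ω`, `F`, `(c, d, e)`. Hypothesis
`hVR` = the hypothesis of record (p287576) VERBATIM; conclusion = (VR_norm) VERBATIM. Needs
`[W.IsElliptic]` (Hasse). Nothing is discharged; both sides remain OPEN labelled hypotheses.
[cite: Castella2018, Thm. 3.1 (arXiv:1704.06608 p. 9)] [cite: Weil1956, §1]
[cite: AtkinLehner1970, Thm. 3] -/
theorem normalizedValueReciprocity_of_valueReciprocity
    (hVR :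
      ∀ (K : Type) [Field K] [NumberField K] (𝔭 : HeightOneSpectrum (𝓞 K)) {N : ℕ} [NeZero N]
        (f : CuspForm (CongruenceSubgroup.Gamma0 N) 2),
        IsNewformOf W f → W.conductorNorm ℤ = N → IsImaginaryQuadratic K → SatisfiesHeegnerHypothesis N K →
        ((Ideal.span {(3 : ℤ)}).primesOver (𝓞 K)).ncard = 2 → ((3 : ℕ) : 𝓞 K) ∈ 𝔭.asIdeal →
        ∃ Ω : ℂ, Ω ≠ 0 ∧
          -- (VR-A) cocycle clause on Aut(ℂ/K); ideal slot = integer-exponent monomial at primes v ∤ 3 (F-i)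
          (∀ σ : ℂ ≃ₐ[ℚ] ℂ, (∀ (φ : K →+* ℂ) (k : K), σ (φ k) = φ k) →
            ∃ (c d : ℂ) (e : HeightOneSpectrum (𝓞 K) →₀ ℤ), c ≠ 0 ∧ d ≠ 0 ∧
              (∀ v ∈ e.support, ((3 : ℕ) : 𝓞 K) ∉ v.asIdeal) ∧
              ∀ (χ : HeckeCharacter K) (n : ℕ), 0 < n →
                (∀ v : HeightOneSpectrum (𝓞 K), χ.IsUnramifiedAt v) →
                ∀ hχ : χ.HasInfinityType (fun _ ↦ (n : ℤ)) (fun _ ↦ -(n : ℤ)),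
                  σ (bdpInterpolationValue 3 f 𝔭 χ n Ω) =
                    d * c ^ n * (e.prod fun v k ↦ (hχ.autConj σ).valueAtUniformizer v ^ k) *
                      bdpInterpolationValue 3 f 𝔭 (hχ.autConj σ) n Ω) ∧
          -- (VR-B) exactness clause on Aut(ℂ/F), F ⊇ K a number field unramified above 3
          (∃ F : IntermediateField ℚ ℂ, FiniteDimensional ℚ F ∧
            (∀ (φ : K →+* ℂ) (k : K), φ k ∈ F) ∧
            (∀ P : Ideal (𝓞 F), P.IsPrime → ((3 : ℕ) : 𝓞 F) ∈ P → P.ramificationIdx (𝓞 ℚ) = 1) ∧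
            ∀ σ : ℂ ≃ₐ[ℚ] ℂ, (∀ x : ℂ, x ∈ F → σ x = x) →
              ∀ (χ : HeckeCharacter K) (n : ℕ), 0 < n →
                (∀ v : HeightOneSpectrum (𝓞 K), χ.IsUnramifiedAt v) →
                ∀ hχ : χ.HasInfinityType (fun _ ↦ (n : ℤ)) (fun _ ↦ -(n : ℤ)),
                  σ (bdpInterpolationValue 3 f 𝔭 χ n Ω) =
                    bdpInterpolationValue 3 f 𝔭 (hχ.autConj σ) n Ω)) :
      ∀ (K : Type) [Field K] [NumberField K] (𝔭 : HeightOneSpectrum (𝓞 K)) {N : ℕ} [NeZero N]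
        (f : CuspForm (CongruenceSubgroup.Gamma0 N) 2),
        IsNewformOf W f → W.conductorNorm ℤ = N → IsImaginaryQuadratic K → SatisfiesHeegnerHypothesis N K →
        ((Ideal.span {(3 : ℤ)}).primesOver (𝓞 K)).ncard = 2 → ((3 : ℕ) : 𝓞 K) ∈ 𝔭.asIdeal →
        ∃ Ω : ℂ, Ω ≠ 0 ∧
          -- (VR-A_norm) cocycle clause on Aut(ℂ/K) for A(χ, n; Ω) = L(f/K, χ, 1)/(π^{2n+1}·Ω^{4n})
          (∀ σ : ℂ ≃ₐ[ℚ] ℂ, (∀ (φ : K →+* ℂ) (k : K), σ (φ k) = φ k) →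
            ∃ (c d : ℂ) (e : HeightOneSpectrum (𝓞 K) →₀ ℤ), c ≠ 0 ∧ d ≠ 0 ∧
              (∀ v ∈ e.support, ((3 : ℕ) : 𝓞 K) ∉ v.asIdeal) ∧
              ∀ (χ : HeckeCharacter K) (n : ℕ), 0 < n →
                (∀ v : HeightOneSpectrum (𝓞 K), χ.IsUnramifiedAt v) →
                ∀ hχ : χ.HasInfinityType (fun _ ↦ (n : ℤ)) (fun _ ↦ -(n : ℤ)),
                  σ (rankinSelbergValueHecke f χ 1 / ((Real.pi : ℂ) ^ (2 * n + 1) * Ω ^ (4 * n))) =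
                    d * c ^ n * (e.prod fun v k ↦ (hχ.autConj σ).valueAtUniformizer v ^ k) *
                      (rankinSelbergValueHecke f (hχ.autConj σ) 1 /
                        ((Real.pi : ℂ) ^ (2 * n + 1) * Ω ^ (4 * n)))) ∧
          -- (VR-B_norm) exactness clause on Aut(ℂ/F), F ⊇ K a number field unramified above 3
          (∃ F : IntermediateField ℚ ℂ, FiniteDimensional ℚ F ∧
            (∀ (φ : K →+* ℂ) (k : K), φ k ∈ F) ∧
            (∀ P : Ideal (𝓞 F), P.IsPrime → ((3 : ℕ) : 𝓞 F) ∈ P → P.ramificationIdx (𝓞 ℚ) = 1) ∧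
            ∀ σ : ℂ ≃ₐ[ℚ] ℂ, (∀ x : ℂ, x ∈ F → σ x = x) →
              ∀ (χ : HeckeCharacter K) (n : ℕ), 0 < n →
                (∀ v : HeightOneSpectrum (𝓞 K), χ.IsUnramifiedAt v) →
                ∀ hχ : χ.HasInfinityType (fun _ ↦ (n : ℤ)) (fun _ ↦ -(n : ℤ)),
                  σ (rankinSelbergValueHecke f χ 1 / ((Real.pi : ℂ) ^ (2 * n + 1) * Ω ^ (4 * n))) =
                    rankinSelbergValueHecke f (hχ.autConj σ) 1 /
                      ((Real.pi : ℂ) ^ (2 * n + 1) * Ω ^ (4 * n))) := by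
  intro K _ _ 𝔭 N _ f hf hN hK hH h2 h𝔭
  obtain ⟨Ω, hΩ, ha', F, hFfin, hKF, hFunr, hb⟩ := hVR K 𝔭 f hf hN hK hH h2 h𝔭
  refine ⟨Ω, hΩ, ?_, ⟨F, hFfin, hKF, hFunr, ?_⟩⟩
  · intro σ hσ
    obtain ⟨c, d, e, hc, hd, he, hcoc⟩ := ha' σ hσ
    refine ⟨c, d, e, hc, hd, he, fun χ n hn hunr hχ ↦ ?_⟩
    exact normalizedValue_cocycle_of_bdpInterpolationValue_cocycle hf Nat.prime_three 𝔭 hχ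
      (fun _ ↦ add_neg_cancel (n : ℤ)) hunr hn Ω _ σ (hcoc χ n hn hunr hχ)
  · intro σ hσ χ n hn hunr hχ
    exact normalizedValue_exact_of_bdpInterpolationValue_exact hf Nat.prime_three 𝔭 hχ
      (fun _ ↦ add_neg_cancel (n : ℤ)) hunr hn Ω σ (hb σ hσ χ n hn hunr hχ)

/-- **(VR) ⟺ (VR_norm)**: the hypothesis of record of the node's terminal form (x11b3-p7 p287576)
is EQUIVALENT, in the kernel, to value reciprocity stated on the bare normalized Rankin–Selberg
central values `L(f/K, χ, 1)/(π^(2n+1)·Ω^(4n))`. WORDING OF RECORD (x11b3-lead GEN 9 R10-30,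
binding): (VR) ⟺ (VR_norm) in the kernel — a REFORMULATION that loses nothing; both OPEN labelled
hypotheses; nothing discharged; nothing booked; the node `Three.HsiehDescentAt₃` is unchanged.
[cite: Castella2018, Thm. 3.1]
[cite: Weil1956, §1] [cite: AtkinLehner1970, Thm. 3] -/
theorem valueReciprocity_iff_normalizedValueReciprocity :
    (
      ∀ (K : Type) [Field K] [NumberField K] (𝔭 : HeightOneSpectrum (𝓞 K)) {N : ℕ} [NeZero N]
        (f : CuspForm (CongruenceSubgroup.Gamma0 N) 2),
        IsNewformOf W f → W.conductorNorm ℤ = N → IsImaginaryQuadratic K → SatisfiesHeegnerHypothesis N K →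
        ((Ideal.span {(3 : ℤ)}).primesOver (𝓞 K)).ncard = 2 → ((3 : ℕ) : 𝓞 K) ∈ 𝔭.asIdeal →
        ∃ Ω : ℂ, Ω ≠ 0 ∧
          -- (VR-A) cocycle clause on Aut(ℂ/K); ideal slot = integer-exponent monomial at primes v ∤ 3 (F-i)
          (∀ σ : ℂ ≃ₐ[ℚ] ℂ, (∀ (φ : K →+* ℂ) (k : K), σ (φ k) = φ k) →
            ∃ (c d : ℂ) (e : HeightOneSpectrum (𝓞 K) →₀ ℤ), c ≠ 0 ∧ d ≠ 0 ∧
              (∀ v ∈ e.support, ((3 : ℕ) : 𝓞 K) ∉ v.asIdeal) ∧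
              ∀ (χ : HeckeCharacter K) (n : ℕ), 0 < n →
                (∀ v : HeightOneSpectrum (𝓞 K), χ.IsUnramifiedAt v) →
                ∀ hχ : χ.HasInfinityType (fun _ ↦ (n : ℤ)) (fun _ ↦ -(n : ℤ)),
                  σ (bdpInterpolationValue 3 f 𝔭 χ n Ω) =
                    d * c ^ n * (e.prod fun v k ↦ (hχ.autConj σ).valueAtUniformizer v ^ k) *
                      bdpInterpolationValue 3 f 𝔭 (hχ.autConj σ) n Ω) ∧
          -- (VR-B) exactness clause on Aut(ℂ/F), F ⊇ K a number field unramified above 3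
          (∃ F : IntermediateField ℚ ℂ, FiniteDimensional ℚ F ∧
            (∀ (φ : K →+* ℂ) (k : K), φ k ∈ F) ∧
            (∀ P : Ideal (𝓞 F), P.IsPrime → ((3 : ℕ) : 𝓞 F) ∈ P → P.ramificationIdx (𝓞 ℚ) = 1) ∧
            ∀ σ : ℂ ≃ₐ[ℚ] ℂ, (∀ x : ℂ, x ∈ F → σ x = x) →
              ∀ (χ : HeckeCharacter K) (n : ℕ), 0 < n →
                (∀ v : HeightOneSpectrum (𝓞 K), χ.IsUnramifiedAt v) →
                ∀ hχ : χ.HasInfinityType (fun _ ↦ (n : ℤ)) (fun _ ↦ -(n : ℤ)),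
                  σ (bdpInterpolationValue 3 f 𝔭 χ n Ω) =
                    bdpInterpolationValue 3 f 𝔭 (hχ.autConj σ) n Ω)) ↔
    (
      ∀ (K : Type) [Field K] [NumberField K] (𝔭 : HeightOneSpectrum (𝓞 K)) {N : ℕ} [NeZero N]
        (f : CuspForm (CongruenceSubgroup.Gamma0 N) 2),
        IsNewformOf W f → W.conductorNorm ℤ = N → IsImaginaryQuadratic K → SatisfiesHeegnerHypothesis N K →
        ((Ideal.span {(3 : ℤ)}).primesOver (𝓞 K)).ncard = 2 → ((3 : ℕ) : 𝓞 K) ∈ 𝔭.asIdeal →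
        ∃ Ω : ℂ, Ω ≠ 0 ∧
          -- (VR-A_norm) cocycle clause on Aut(ℂ/K) for A(χ, n; Ω) = L(f/K, χ, 1)/(π^{2n+1}·Ω^{4n})
          (∀ σ : ℂ ≃ₐ[ℚ] ℂ, (∀ (φ : K →+* ℂ) (k : K), σ (φ k) = φ k) →
            ∃ (c d : ℂ) (e : HeightOneSpectrum (𝓞 K) →₀ ℤ), c ≠ 0 ∧ d ≠ 0 ∧
              (∀ v ∈ e.support, ((3 : ℕ) : 𝓞 K) ∉ v.asIdeal) ∧
              ∀ (χ : HeckeCharacter K) (n : ℕ), 0 < n →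
                (∀ v : HeightOneSpectrum (𝓞 K), χ.IsUnramifiedAt v) →
                ∀ hχ : χ.HasInfinityType (fun _ ↦ (n : ℤ)) (fun _ ↦ -(n : ℤ)),
                  σ (rankinSelbergValueHecke f χ 1 / ((Real.pi : ℂ) ^ (2 * n + 1) * Ω ^ (4 * n))) =
                    d * c ^ n * (e.prod fun v k ↦ (hχ.autConj σ).valueAtUniformizer v ^ k) *
                      (rankinSelbergValueHecke f (hχ.autConj σ) 1 /
                        ((Real.pi : ℂ) ^ (2 * n + 1) * Ω ^ (4 * n)))) ∧
          -- (VR-B_norm) exactness clause on Aut(ℂ/F), F ⊇ K a number field unramified above 3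
          (∃ F : IntermediateField ℚ ℂ, FiniteDimensional ℚ F ∧
            (∀ (φ : K →+* ℂ) (k : K), φ k ∈ F) ∧
            (∀ P : Ideal (𝓞 F), P.IsPrime → ((3 : ℕ) : 𝓞 F) ∈ P → P.ramificationIdx (𝓞 ℚ) = 1) ∧
            ∀ σ : ℂ ≃ₐ[ℚ] ℂ, (∀ x : ℂ, x ∈ F → σ x = x) →
              ∀ (χ : HeckeCharacter K) (n : ℕ), 0 < n →
                (∀ v : HeightOneSpectrum (𝓞 K), χ.IsUnramifiedAt v) →
                ∀ hχ : χ.HasInfinityType (fun _ ↦ (n : ℤ)) (fun _ ↦ -(n : ℤ)),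
                  σ (rankinSelbergValueHecke f χ 1 / ((Real.pi : ℂ) ^ (2 * n + 1) * Ω ^ (4 * n))) =
                    rankinSelbergValueHecke f (hχ.autConj σ) 1 /
                      ((Real.pi : ℂ) ^ (2 * n + 1) * Ω ^ (4 * n)))) :=
  ⟨normalizedValueReciprocity_of_valueReciprocity W, valueReciprocity_of_normalizedValueReciprocity W⟩

end Converse

end Summit.BirchSwinnertonDyer.Rank1Residual.X11b.Three
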